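import Mathlib
import Literature.Analysis.FluidPDE.HardSphereCollisionRecord
import Literature.Analysis.FluidPDE.HardSphereTorusMeasure
import Literature.Analysis.FluidPDE.HardSphereDynamicsProofs
import Literature.Analysis.FluidPDE.HardSphereFlowJointMeasurable
import Literature.MathematicalPhysics.KineticTheory.HardSphereEuler
import Literature.MathematicalPhysics.KineticTheory.HardSphereEulerProofs
import Summits.AtomisticToContinuum.HydrodynamicLimit.Theorems.OneFlightGossipEngineOneFlightLayeredChaosFirstFlightGhostGlue
import HarnessLib

/-!
# `OneFlightGossipEngine.OneFlightLayeredChaos` — joint measurability of the ghost-avoidance event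
(crux stmt-AtomisticToContinuum-14535, line `Sketch`, lead c4 wave 2; a brick of the first-rung transfer
`TwoDirectionGhostInput → FirstFlightGhostInput`; registered stub `measurableSet_ghostAvoid`).

The GHOST AVOIDANCE EVENT of the first rung: a datum `z` of `n` particles on `𝕋³`, an embedding `emb` of `m` ghost
labels and a hard-sphere flow `Ψ` of the `m` ghosts; the event `{(t, z)}` says that the ghost part `z ∘ emb` is
`Ψ`-good and that during the horizon `(0, t]` every ghost sphere `(Ψ_u (z ∘ emb) k).1` stays at minimal-image distance
`> ε` from the free flights of `i` and of `j`.  The transfer integrates this event over the horizon `t` (Fubini in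
`(t, z)`), so the event has to be measurable JOINTLY in `p = (t, z) ∈ ℝ × Config n (Fin 3) T3`; this file proves it.

Proof.  The flow is extended measurably off its good set (`(u, y) ↦ Ψ_u y` on `ℝ × good`, `y` elsewhere:
jointly measurable by `HardSphereFlow.measurable_flow_prod_torus`, with positions continuous in `u` by
`IsHardSphereTrajectory.pos_continuous`); each distance `d(u, p) = ‖sepVec (ghost k at u) (free flight of l at u)‖`
is then jointly measurable in `(u, p)` and continuous in `u`.  The uncountable condition `∀ u ∈ (0, t], ε < d(u, p)`
is reduced to countably many closed conditions WITHOUT a margin at `u → 0`: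
`∀ N, ∃ M, ∀ r ∈ ℚ, 0 < t → ε + 1/(M+1) ≤ d(clamp_N(r) · t, p)` with `clamp_N r = max (1/(N+2)) (min r 1)`
(compactness of `[t/(N+2), t]` for `⇒`, density of `ℚ` and closedness of `≤` for `⇐`), and each basic set is
measurable (`measurableSet_le`).  Theorems only; no definition.

References: C. Cercignani, R. Illner, M. Pulvirenti, *The Mathematical Theory of Dilute Gases* (1994), §4.2, App. 4.A
(measurability of events of the hard-sphere flow is implicit whenever they are integrated against a law).
-/

open scoped Topology
open MeasureTheory Set Filter
open Literature.Analysis.FluidPDE Literature.MathematicalPhysics.KineticTheory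
open Summit.AtomisticToContinuum.HydrodynamicLimit.Theorems

namespace Summit.AtomisticToContinuum.HydrodynamicLimit.Theorems.OLC

noncomputable section

/-! ## A countable description of "a continuous function stays above `c` on `(0, τ]`" -/

section Countable

/-- For a continuous `g : ℝ → ℝ`: `g > c` on `(0, τ]` iff for every `N` there is a uniform margin `1/(M+1)` on
`[τ/(N+2), τ]`, tested at the clamped rational multiples `max (1/(N+2)) (min r 1) · τ` of `τ` (compactness gives the
margin; density of `ℚ` and continuity give it back at every point). The guard `0 < τ` makes both sides trivially true
when the horizon is empty. [folklore] -/
theorem forall_Ioc_lt_iff_rat {g : ℝ → ℝ} (hg : Continuous g) (c τ : ℝ) :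
    (∀ u ∈ Ioc 0 τ, c < g u) ↔
      ∀ N : ℕ, ∃ M : ℕ, ∀ r : ℚ, 0 < τ →
        c + 1 / ((M : ℝ) + 1) ≤ g (max (1 / ((N : ℝ) + 2)) (min (r : ℝ) 1) * τ) := by
  constructor
  · intro h N
    by_cases hτ : 0 < τ
    · have hK : IsCompact (Icc (1 / ((N : ℝ) + 2)) 1) := isCompact_Icc
      have hcont : ContinuousOn (fun s : ℝ => g (s * τ)) (Icc (1 / ((N : ℝ) + 2)) 1) :=
        (hg.comp (continuous_id.mul continuous_const)).continuousOn
      have hpos : (0 : ℝ) < 1 / ((N : ℝ) + 2) := by positivity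
      have hlt : ∀ s ∈ Icc (1 / ((N : ℝ) + 2)) 1, c < g (s * τ) := by
        intro s hs
        refine h _ ⟨mul_pos (hpos.trans_le hs.1) hτ, ?_⟩
        calc s * τ ≤ 1 * τ := mul_le_mul_of_nonneg_right hs.2 hτ.le
          _ = τ := one_mul τ
      obtain ⟨a', ha', hle⟩ := hK.exists_forall_le' hcont hlt
      obtain ⟨M, hM⟩ := exists_nat_one_div_lt (sub_pos.2 ha')
      refine ⟨M, fun r _ => ?_⟩
      have hN1 : 1 / ((N : ℝ) + 2) ≤ 1 := by
        rw [div_le_one (by positivity)]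
        linarith
      have hmem : max (1 / ((N : ℝ) + 2)) (min (r : ℝ) 1) ∈ Icc (1 / ((N : ℝ) + 2)) 1 :=
        ⟨le_max_left _ _, max_le hN1 (min_le_right _ _)⟩
      have := hle _ hmem
      linarith
    · exact ⟨0, fun r h' => absurd h' hτ⟩
  · intro h u hu
    have hτ : 0 < τ := hu.1.trans_le hu.2
    have hs : 0 < u / τ := div_pos hu.1 hτ
    have hs1 : u / τ ≤ 1 := (div_le_one hτ).2 hu.2
    obtain ⟨N, hN⟩ := exists_nat_one_div_lt hs
    have hN' : 1 / ((N : ℝ) + 2) ≤ u / τ := by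
      have : 1 / ((N : ℝ) + 2) ≤ 1 / ((N : ℝ) + 1) :=
        one_div_le_one_div_of_le (by positivity) (by linarith)
      linarith
    obtain ⟨M, hM⟩ := h N
    have hclosed : IsClosed {x : ℝ | c + 1 / ((M : ℝ) + 1) ≤
        g (max (1 / ((N : ℝ) + 2)) (min x 1) * τ)} :=
      isClosed_le continuous_const
        (hg.comp ((continuous_const.max (continuous_id.min continuous_const)).mul continuous_const))
    have hall := isClosed_property Rat.denseRange_cast hclosed (fun r => hM r hτ)
    have hx := hall (u / τ)
    rw [min_eq_left hs1, max_eq_right hN', div_mul_cancel₀ u hτ.ne'] at hx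
    have hMpos : (0 : ℝ) < 1 / ((M : ℝ) + 1) := by positivity
    linarith

/-- **Measurability of "stays above `c` during a measurable horizon".** If `F : ℝ × α → ℝ` is jointly measurable
and continuous in the time variable, and `τ : α → ℝ` is measurable, then `{a | ∀ u ∈ (0, τ a], c < F (u, a)}` is
measurable (countable description `forall_Ioc_lt_iff_rat`; each basic set is a `measurableSet_le`). [folklore] -/
theorem measurableSet_forall_Ioc_lt {α : Type*} [MeasurableSpace α] {F : ℝ × α → ℝ} (hF : Measurable F)
    (hc : ∀ a, Continuous fun u => F (u, a)) {τ : α → ℝ} (hτ : Measurable τ) (c : ℝ) :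
    MeasurableSet {a | ∀ u ∈ Ioc 0 (τ a), c < F (u, a)} := by
  have hS : {a | ∀ u ∈ Ioc 0 (τ a), c < F (u, a)} =
      ⋂ N : ℕ, ⋃ M : ℕ, ⋂ r : ℚ, {a | 0 < τ a →
        c + 1 / ((M : ℝ) + 1) ≤ F (max (1 / ((N : ℝ) + 2)) (min (r : ℝ) 1) * τ a, a)} := by
    ext a
    simp only [mem_setOf_eq, mem_iInter, mem_iUnion]
    exact forall_Ioc_lt_iff_rat (hc a) c (τ a)
  rw [hS]
  refine MeasurableSet.iInter fun N => MeasurableSet.iUnion fun M => MeasurableSet.iInter fun r => ?_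
  have h1 : Measurable fun a => F (max (1 / ((N : ℝ) + 2)) (min (r : ℝ) 1) * τ a, a) :=
    hF.comp ((measurable_const.mul hτ).prodMk measurable_id)
  have h2 : MeasurableSet {a | c + 1 / ((M : ℝ) + 1) ≤
      F (max (1 / ((N : ℝ) + 2)) (min (r : ℝ) 1) * τ a, a)} :=
    measurableSet_le measurable_const h1
  have h3 : MeasurableSet {a | 0 < τ a} := measurableSet_lt measurable_const hτ
  have h4 : {a | 0 < τ a → c + 1 / ((M : ℝ) + 1) ≤ F (max (1 / ((N : ℝ) + 2)) (min (r : ℝ) 1) * τ a, a)} =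
      {a | 0 < τ a}ᶜ ∪ {a | c + 1 / ((M : ℝ) + 1) ≤
        F (max (1 / ((N : ℝ) + 2)) (min (r : ℝ) 1) * τ a, a)} := by
    ext a
    simp only [mem_setOf_eq, mem_union, mem_compl_iff, imp_iff_not_or]
  rw [h4]
  exact h3.compl.union h2

end Countable

/-! ## A measurable extension of the ghost flow off its good set -/

section Flow

variable {n m : ℕ} {ε : ℝ}

/-- A hard-sphere flow on `𝕋³` has a jointly measurable modification off its good set: `Θ (u, y) = Ψ_u y` for good
`y` (jointly measurable there, `HardSphereFlow.measurable_flow_prod_torus`) and `Θ (u, y) = y` otherwise; in both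
cases the positions `u ↦ (Θ (u, y) k).1` are continuous (`IsHardSphereTrajectory.pos_continuous`). Outside the good
set `Ψ` itself is junk, so nothing is lost. [folklore] -/
theorem exists_measurable_flow_extension (Ψ : HardSphereFlow (Torus.geometry (Fin 3)) ε m) :
    ∃ Θ : ℝ × Config m (Fin 3) T3 → Config m (Fin 3) T3, Measurable Θ ∧
      (∀ (u : ℝ) (y : Config m (Fin 3) T3), y ∈ Ψ.good → Θ (u, y) = Ψ.flow u y) ∧
      ∀ (y : Config m (Fin 3) T3) (k : Fin m), Continuous fun u : ℝ => (Θ (u, y) k).1 := by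
  classical
  refine ⟨fun q => if hq : q ∈ {q : ℝ × Config m (Fin 3) T3 | q.2 ∈ Ψ.good} then Ψ.flow q.1 q.2 else q.2,
    ?_, ?_, ?_⟩
  · refine Measurable.dite (s := {q : ℝ × Config m (Fin 3) T3 | q.2 ∈ Ψ.good})
      (f := fun q => Ψ.flow q.1.1 q.1.2) (g := fun q => q.1.2) ?_ ?_ (measurable_snd Ψ.measurableSet_good)
    · have h1 : Measurable fun q : {q : ℝ × Config m (Fin 3) T3 | q.2 ∈ Ψ.good} =>
          ((⟨q.1.2, q.2⟩ : Ψ.good), q.1.1) :=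
        ((measurable_snd.comp measurable_subtype_coe).subtype_mk).prodMk
          (measurable_fst.comp measurable_subtype_coe)
      exact Ψ.measurable_flow_prod_torus.comp h1
    · exact measurable_snd.comp measurable_subtype_coe
  · intro u y hy
    have hy' : (u, y) ∈ {q : ℝ × Config m (Fin 3) T3 | q.2 ∈ Ψ.good} := hy
    simp only [hy', dite_true]
  · intro y k
    by_cases hy : y ∈ Ψ.good
    · have hy' : ∀ u : ℝ, (u, y) ∈ {q : ℝ × Config m (Fin 3) T3 | q.2 ∈ Ψ.good} := fun u => hy
      simp only [hy', dite_true]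
      exact (Ψ.isTrajectory y hy).pos_continuous k
    · have hy' : ∀ u : ℝ, (u, y) ∉ {q : ℝ × Config m (Fin 3) T3 | q.2 ∈ Ψ.good} := fun u => hy
      simp only [hy', dite_false]
      exact continuous_const

/-- The free-flight position `(u, z) ↦ (z l).1 + proj (u • (z l).2)` on `𝕋³` is jointly continuous. [folklore] -/
theorem continuous_freeFlight_pos_prod (l : Fin n) :
    Continuous fun q : ℝ × Config n (Fin 3) T3 => (freeFlight (Torus.geometry (Fin 3)) q.1 q.2 l).1 := by
  simp only [freeFlight_apply, Torus.geometry_translate]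
  have h1 : Continuous fun q : ℝ × Config n (Fin 3) T3 => q.2 l := (continuous_apply l).comp continuous_snd
  exact h1.fst.add (Literature.Analysis.FunctionSpaces.Torus.continuous_proj.comp (continuous_fst.smul h1.snd))

/-- The distance between the `k`-th (extended) ghost sphere and the free flight of `l`,
`(u, (t, z)) ↦ ‖sepVec (Θ (u, z ∘ emb) k).1 (freeFlight u z l).1‖`, is jointly measurable. [folklore] -/
theorem measurable_ghostDist (emb : Fin m ↪ Fin n) {Θ : ℝ × Config m (Fin 3) T3 → Config m (Fin 3) T3}
    (hΘ : Measurable Θ) (k : Fin m) (l : Fin n) :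
    Measurable fun q : ℝ × (ℝ × Config n (Fin 3) T3) =>
      ‖(Torus.geometry (Fin 3)).sepVec (Θ (q.1, (q.2.2 ∘ emb : Config m (Fin 3) T3)) k).1
        (freeFlight (Torus.geometry (Fin 3)) q.1 q.2.2 l).1‖ := by
  have h1 : Measurable fun q : ℝ × (ℝ × Config n (Fin 3) T3) =>
      (Θ (q.1, (q.2.2 ∘ emb : Config m (Fin 3) T3)) k).1 :=
    ((measurable_pi_apply k).comp (hΘ.comp (measurable_fst.prodMk
      ((measurable_comp_emb emb).comp (measurable_snd.comp measurable_snd))))).fst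
  have h2 : Measurable fun q : ℝ × (ℝ × Config n (Fin 3) T3) =>
      (freeFlight (Torus.geometry (Fin 3)) q.1 q.2.2 l).1 :=
    (continuous_freeFlight_pos_prod l).measurable.comp
      (measurable_fst.prodMk (measurable_snd.comp measurable_snd))
  exact (Torus.measurable_geometry_sepVec.comp (h1.prodMk h2)).norm

/-- For fixed `p = (t, z)` the same distance is continuous in the time `u` (positions of the extended flow are
continuous, free flight is continuous, the minimal-image distance is continuous). [folklore] -/
theorem continuous_ghostDist (emb : Fin m ↪ Fin n) {Θ : ℝ × Config m (Fin 3) T3 → Config m (Fin 3) T3}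
    (hΘc : ∀ (y : Config m (Fin 3) T3) (k : Fin m), Continuous fun u : ℝ => (Θ (u, y) k).1)
    (k : Fin m) (l : Fin n) (p : ℝ × Config n (Fin 3) T3) :
    Continuous fun u : ℝ =>
      ‖(Torus.geometry (Fin 3)).sepVec (Θ (u, (p.2 ∘ emb : Config m (Fin 3) T3)) k).1
        (freeFlight (Torus.geometry (Fin 3)) u p.2 l).1‖ := by
  have h1 := hΘc (p.2 ∘ emb) k
  have h2 : Continuous fun u : ℝ => (freeFlight (Torus.geometry (Fin 3)) u p.2 l).1 :=
    (continuous_freeFlight_pos_prod l).comp (continuous_id.prodMk continuous_const)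
  simp only [Torus.norm_geometry_sepVec]
  simpa only [Function.comp_def] using Torus.continuous_euclidDist.comp (h1.prodMk h2)

end Flow

/-! ## The registered stub -/

/-- **Joint measurability of the ghost-avoidance event (registered stub `measurableSet_ghostAvoid`).** For a
hard-sphere flow `Ψ` of `m` ghosts on `𝕋³`, labels `i j : Fin n` and an embedding `emb : Fin m ↪ Fin n`, the set of
`(t, z) ∈ ℝ × Config n (Fin 3) T3` such that `z ∘ emb` is `Ψ`-good and every ghost sphere stays at minimal-image
distance `> ε` from the free flights of `i` and `j` during `(0, t]` is measurable. Proof: replace `Ψ` by its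
measurable extension `Θ` (they agree on the good ghost part), split the event as
`{good} ∩ ⋂ₖ ({∀ u, ε < d_{k,i}} ∩ {∀ u, ε < d_{k,j}})` and apply `measurableSet_forall_Ioc_lt` to each jointly
measurable, time-continuous distance. [folklore] -/
theorem measurableSet_ghostAvoid : ∀ {ε : ℝ} {n m : ℕ} (Ψ : Literature.Analysis.FluidPDE.HardSphereFlow (Literature.Analysis.FluidPDE.Torus.geometry (Fin 3)) ε m) (i j : Fin n) (emb : Fin m ↪ Fin n), MeasurableSet {p : ℝ × Literature.Analysis.FluidPDE.Config n (Fin 3) Literature.MathematicalPhysics.KineticTheory.T3 | (p.2 ∘ emb : Literature.Analysis.FluidPDE.Config m (Fin 3) Literature.MathematicalPhysics.KineticTheory.T3) ∈ Ψ.good ∧ ∀ u ∈ Set.Ioc 0 p.1, ∀ k : Fin m, ε < ‖(Literature.Analysis.FluidPDE.Torus.geometry (Fin 3)).sepVec (Ψ.flow u (p.2 ∘ emb) k).1 (Literature.Analysis.FluidPDE.freeFlight (Literature.Analysis.FluidPDE.Torus.geometry (Fin 3)) u p.2 i).1‖ ∧ ε < ‖(Literature.Analysis.FluidPDE.Torus.geometry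 (Fin 3)).sepVec (Ψ.flow u (p.2 ∘ emb) k).1 (Literature.Analysis.FluidPDE.freeFlight (Literature.Analysis.FluidPDE.Torus.geometry (Fin 3)) u p.2 j).1‖} := by
  intro ε n m Ψ i j emb
  obtain ⟨Θ, hΘm, hΘeq, hΘc⟩ := exists_measurable_flow_extension Ψ
  have hA : MeasurableSet {p : ℝ × Config n (Fin 3) T3 | (p.2 ∘ emb : Config m (Fin 3) T3) ∈ Ψ.good} :=
    ((measurable_comp_emb emb).comp measurable_snd) Ψ.measurableSet_good
  have hB : ∀ (k : Fin m) (l : Fin n), MeasurableSet {p : ℝ × Config n (Fin 3) T3 | ∀ u ∈ Ioc 0 p.1,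
      ε < ‖(Torus.geometry (Fin 3)).sepVec (Θ (u, (p.2 ∘ emb : Config m (Fin 3) T3)) k).1
        (freeFlight (Torus.geometry (Fin 3)) u p.2 l).1‖} := fun k l =>
    measurableSet_forall_Ioc_lt (measurable_ghostDist emb hΘm k l)
      (fun p => continuous_ghostDist emb hΘc k l p) measurable_fst ε
  have hS : {p : ℝ × Config n (Fin 3) T3 | (p.2 ∘ emb : Config m (Fin 3) T3) ∈ Ψ.good ∧
      ∀ u ∈ Ioc 0 p.1, ∀ k : Fin m,
        ε < ‖(Torus.geometry (Fin 3)).sepVec (Ψ.flow u (p.2 ∘ emb) k).1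
          (freeFlight (Torus.geometry (Fin 3)) u p.2 i).1‖ ∧
        ε < ‖(Torus.geometry (Fin 3)).sepVec (Ψ.flow u (p.2 ∘ emb) k).1
          (freeFlight (Torus.geometry (Fin 3)) u p.2 j).1‖} =
      {p : ℝ × Config n (Fin 3) T3 | (p.2 ∘ emb : Config m (Fin 3) T3) ∈ Ψ.good} ∩
        ⋂ k : Fin m, ({p : ℝ × Config n (Fin 3) T3 | ∀ u ∈ Ioc 0 p.1,
            ε < ‖(Torus.geometry (Fin 3)).sepVec (Θ (u, (p.2 ∘ emb : Config m (Fin 3) T3)) k).1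
              (freeFlight (Torus.geometry (Fin 3)) u p.2 i).1‖} ∩
          {p : ℝ × Config n (Fin 3) T3 | ∀ u ∈ Ioc 0 p.1,
            ε < ‖(Torus.geometry (Fin 3)).sepVec (Θ (u, (p.2 ∘ emb : Config m (Fin 3) T3)) k).1
              (freeFlight (Torus.geometry (Fin 3)) u p.2 j).1‖}) := by
    ext p
    simp only [mem_setOf_eq, mem_inter_iff, mem_iInter]
    constructor
    · rintro ⟨hg, h⟩
      refine ⟨hg, fun k => ⟨fun u hu => ?_, fun u hu => ?_⟩⟩
      · rw [hΘeq u _ hg]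
        exact (h u hu k).1
      · rw [hΘeq u _ hg]
        exact (h u hu k).2
    · rintro ⟨hg, h⟩
      refine ⟨hg, fun u hu k => ?_⟩
      have h1 := (h k).1 u hu
      have h2 := (h k).2 u hu
      rw [hΘeq u _ hg] at h1 h2
      exact ⟨h1, h2⟩
  rw [hS]
  exact hA.inter (MeasurableSet.iInter fun k => (hB k i).inter (hB k j))

end

end Summit.AtomisticToContinuum.HydrodynamicLimit.Theorems.OLC
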